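import Summits.Ventures.CertifiedArithmetic.LowPrec.DoubleRoundingSlipWide

/-!
# Double rounding of square roots (THEOREM D-sqrt, the clause for every pair of records)

HONEST FRAMING: certified error envelopes and provably optimal rounding/accumulation schemes for
low-precision formats under stated cost models; every table by two implementations; no hardware
or vendor claims.

`fl_φ (fl_ψ (√a)) = fl_φ (√a)` for every value `a ≥ 0` of `φ`: ONE square root executed (correctly
rounded) in the wider format `ψ` and converted to `φ` is the correctly rounded square root of `φ`
(both roundings the saturating round-to-nearest-even `roundNE` of this packet, subnormals kept).
The root is irrational in general; `RoundSqrt.lean` replaces it by a rational SURROGATE in the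
same open half-quantum cell of `ψ` (`ν = quantum_ψ / 2`): `x = n ν` if `√a = n ν` is a multiple
of `ν`, else the midpoint `x = (n + ½) ν` of the cell `(n ν, (n+1) ν) ∋ √a`; `fl_ψ x = fl_ψ (√a)`
and, the grid of `φ` being coarser, `fl_φ x = fl_φ (√a)`. This file is stated on that surrogate
and imports nothing about square roots: `drSqrt_pos` says that under the clause below the double
rounding of `x` through `ψ` is innocuous; `DoubleRoundingSqrtMatrix.lean` turns it into
`DRSqrt φ ψ` (`drSqrt_of_clause`) and decides the named `13 × 13` matrix.

## THE SQUARE-ROOT CLAUSE (S), for EVERY pair of format records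

`F_φ ⊆ F_ψ` (`embedsTest`), `P_ψ ≥ 2 P_φ + 2` (`2 m_φ + 3 ≤ m_ψ`), `2 (L_ψ + P_ψ - 1) ≤ L_φ`
(`2 (qexp ψ + m_ψ) ≤ qexp φ`: the root of the quantum of `φ` — below which no positive operand
lies — is a NORMAL number of `ψ`), `m_φ ≥ 1`, `L_ψ < L_φ`. No bias hypothesis.

ANATOMY OF A SLIP (the proof; `sqrt_slip_core` is its integer heart). A slip at `x > 0` forces
(`slip_midpoint_of_pos_of_qexp_lt`, Property 2.1 of `DoubleRoundingSlipWide.lean`) `fl_ψ x = m`,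
the midpoint of two neighbours `v < u` of `φ`, `x ≠ m`. In units of `ν` (`2^W ν = 1`): `m = M ν`,
`M = (2V+1) 2^g < 2^(P_φ+g+1)`; `m` is normal in `ψ` by the underflow hypothesis, so
`2^(m_ψ+t+1) ≤ M < 2^(m_ψ+t+2)` and `2^(t+1) ∣ M` with `2^t ν` half an ulp of `ψ` at `m`
(`t = expCode - 1`), and `|x - m| ≤ 2^t ν` (`abs_sub_roundNE_le_half_ulp_of_pos`). The operand is
`a = Z ν²` with `Z = A 2^κ`, `A < 2^P_φ` the odd part of its significand; the surrogate pins
`(M - 2^t)² ≤ Z ≤ (M + 2^t)²`, `Z ≠ M²`. Then `D = Z - M² ≠ 0` has `|D| < 2^(t+1) M + 2^(2t)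
≤ 2^(2t+m_ψ+3) - 3·4^t`, while `2^(2t+m_ψ+3)` divides `D`: it divides `2^(2g)` because
`2^(m_ψ+t+1) ≤ M < 2^(P_φ+g+1)` gives `g ≥ m_ψ + t + 1 - P_φ` and `m_ψ ≥ 2 P_φ - 1`… precisely
`m_ψ - 1 ≥ 2 P_φ`; it divides `2^κ` because `9·4^(m_ψ+t-1) ≤ (M - 2^t)² ≤ Z < 2^(P_φ+κ)`.
Contradiction. `a = 0` gives `0` on both routes; operands are `≥ 0` by definition of `DRSqrt`.

PLACEMENT: innocuous double rounding of square roots for `p₂ ≥ 2 p₁ + 2` with unbounded exponents,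
and its optimality, is [Figueroa1995]; [Roux2014, Thm 25, Rem 26, Table II] formalises it
(Coq/Flocq, any tie rule, no overflow) with gradual underflow under
`emin₂ ≤ emin₁ - p₁ - 2 ∨ 2 emin₂ ≤ emin₁ - 4 p₁ - 2`. The clause here is specific to ties-to-even
and to the saturating records of this packet; its underflow hypothesis is Roux's second disjunct
at `p₂ = 2 p₁ + 2` and is not claimed sharp (implementation A tabulates toy records around it:
`DOUBLE-ROUNDING-SQRT.md` §5). We found no statement of the finite matrix in the literature
searched (queries in the cell's notes). No hardware or vendor claims.
-/

namespace Summit.Ventures.CertifiedArithmetic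

open Literature.ComputerArithmetic.FloatingPoint
open Literature.ComputerArithmetic.FloatingPoint.Format
open Literature.ComputerArithmetic.FloatingPoint.MiniFloat

/-! ## §1 The integer heart -/

/-- THE INTEGER HEART OF THEOREM D-sqrt. With `A < 2^P`, `2P ≤ d` (`d = m_ψ - 1`),
`M = (2V+1) 2^g`, `2^(d+t+2) ≤ M < 2^(d+t+3)`, `M < 2^(P+g+1)`, `2^(t+1) ∣ M`: the integer
`Z = A 2^κ` cannot satisfy `(M - 2^t)² ≤ Z ≤ (M + 2^t)²` unless `Z = M²`. [this packet] -/
theorem sqrt_slip_core {P d t g κ V A : ℕ} {M : ℤ} (hA : (A : ℤ) < 2 ^ P) (hd : 2 * P ≤ d)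
    (hM : M = (2 * V + 1) * 2 ^ g) (hMlo : (2:ℤ) ^ (d + t + 2) ≤ M)
    (hMhi : M < 2 ^ (d + t + 3)) (hMlt : M < 2 ^ (P + g + 1)) (hdvd : (2:ℤ) ^ (t + 1) ∣ M)
    (hZlo : (M - 2 ^ t) ^ 2 ≤ (A : ℤ) * 2 ^ κ) (hZhi : (A : ℤ) * 2 ^ κ ≤ (M + 2 ^ t) ^ 2)
    (hne : (A : ℤ) * 2 ^ κ ≠ M ^ 2) : False := by
  have two_pow_lt : ∀ {i j : ℕ}, (2:ℤ) ^ i < 2 ^ j → i < j := fun h =>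
    (pow_lt_pow_iff_right₀ (by norm_num : (1:ℤ) < 2)).mp h
  -- (1) `g ≥ d + t + 2 - P`, hence `2g ≥ 2t + d + 4`
  have hg : d + t + 2 ≤ P + g := by have := two_pow_lt (hMlo.trans_lt hMlt); omega
  -- (2) `κ ≥ 2t + d + 4`: `9·4^(d+t) ≤ (M - 2^t)² ≤ Z < 2^(P+κ)`
  have hκ : 2 * t + d + 4 ≤ κ := by
    have h1 : (3:ℤ) * 2 ^ (d + t) ≤ M - 2 ^ t := by
      have : (2:ℤ) ^ t ≤ 2 ^ (d + t) := pow_le_pow_right₀ (by norm_num) (by omega)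
      have e : (2:ℤ) ^ (d + t + 2) = 4 * 2 ^ (d + t) := by rw [pow_add]; ring
      linarith
    have h2 : (9:ℤ) * 2 ^ (2 * (d + t)) ≤ (M - 2 ^ t) ^ 2 := by
      calc (9:ℤ) * 2 ^ (2 * (d + t)) = (3 * 2 ^ (d + t)) ^ 2 := by ring
        _ ≤ (M - 2 ^ t) ^ 2 := pow_le_pow_left₀ (by positivity) h1 2
    have h3 : (M - 2 ^ t) ^ 2 < (2:ℤ) ^ (P + κ) := by
      rw [pow_add]; exact hZlo.trans_lt (mul_lt_mul_of_pos_right hA (by positivity))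
    have h4 : (2:ℤ) ^ (2 * (d + t) + 3) < 2 ^ (P + κ) := by
      have e : (2:ℤ) ^ (2 * (d + t) + 3) = 8 * 2 ^ (2 * (d + t)) := by rw [pow_add]; ring
      have hX : (0:ℤ) < 2 ^ (2 * (d + t)) := by positivity
      rw [e]; linarith
    have := two_pow_lt h4; omega
  -- (3) `|D| < 2^μ`, `μ = 2t + d + 4`, for `D = Z - M²`
  obtain ⟨M', hM'⟩ := hdvd
  have hM'hi : M' + 1 ≤ (2:ℤ) ^ (d + 2) := by
    have e : (2:ℤ) ^ (d + t + 3) = 2 ^ (t + 1) * 2 ^ (d + 2) := by rw [← pow_add]; congr 1; omega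
    have h1 : (2:ℤ) ^ (t + 1) * M' < 2 ^ (t + 1) * 2 ^ (d + 2) := by rw [← hM', ← e]; exact hMhi
    have := lt_of_mul_lt_mul_left h1 (by positivity); omega
  have hB : (2:ℤ) ^ (t + 1) * M + 2 ^ (2 * t) < 2 ^ (2 * t + d + 4) := by
    have e1 : (2:ℤ) ^ (2 * t + d + 4) = 2 ^ (t + 1) * 2 ^ (t + 1) * 2 ^ (d + 2) := by
      rw [← pow_add, ← pow_add]; congr 1; omega
    have e2 : (2:ℤ) ^ (2 * t) < 2 ^ (t + 1) * 2 ^ (t + 1) := by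
      rw [← pow_add]; exact pow_lt_pow_right₀ (by norm_num) (by omega)
    have hp : (0:ℤ) < 2 ^ (t + 1) * 2 ^ (t + 1) := by positivity
    have e3 := mul_le_mul_of_nonneg_left hM'hi hp.le
    rw [hM', e1]; linarith
  have hDhi : (A : ℤ) * 2 ^ κ - M ^ 2 < 2 ^ (2 * t + d + 4) := by
    have e : (M + 2 ^ t) ^ 2 = M ^ 2 + (2 ^ (t + 1) * M + 2 ^ (2 * t)) := by ring
    linarith
  have hDlo : -(2:ℤ) ^ (2 * t + d + 4) < (A : ℤ) * 2 ^ κ - M ^ 2 := by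
    have e : (M - 2 ^ t) ^ 2 = M ^ 2 - (2 ^ (t + 1) * M - 2 ^ (2 * t)) := by ring
    have : (0:ℤ) ≤ 2 ^ (2 * t) := by positivity
    linarith
  -- (4) `2^μ ∣ D ≠ 0`
  obtain ⟨i, hi⟩ : ∃ i, κ = (2 * t + d + 4) + i := ⟨κ - (2 * t + d + 4), by omega⟩
  obtain ⟨j, hj⟩ : ∃ j, g + g = (2 * t + d + 4) + j := ⟨g + g - (2 * t + d + 4), by omega⟩
  set K : ℤ := (A : ℤ) * 2 ^ i - (2 * V + 1) ^ 2 * 2 ^ j with hK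
  have hDK : (A : ℤ) * 2 ^ κ - M ^ 2 = 2 ^ (2 * t + d + 4) * K := by
    have eκ : (2:ℤ) ^ κ = 2 ^ (2 * t + d + 4) * 2 ^ i := by rw [← pow_add, hi]
    have eg : (2:ℤ) ^ g * 2 ^ g = 2 ^ (2 * t + d + 4) * 2 ^ j := by rw [← pow_add, ← pow_add, hj]
    have eM : ((2 * (V : ℤ) + 1) * 2 ^ g) ^ 2 = (2 * V + 1) ^ 2 * (2 ^ g * 2 ^ g) := by ring
    rw [hK, hM, eκ, eM, eg]; ring
  have hK0 : K ≠ 0 := by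
    intro h0; apply hne; rw [← sub_eq_zero, hDK, h0, mul_zero]
  have hK1 : 1 ≤ |K| := Int.one_le_abs hK0
  have habsD : (2:ℤ) ^ (2 * t + d + 4) ≤ |(A : ℤ) * 2 ^ κ - M ^ 2| := by
    rw [hDK, abs_mul, abs_of_pos (by positivity : (0:ℤ) < 2 ^ (2 * t + d + 4))]
    exact le_mul_of_one_le_right (by positivity) hK1
  have := abs_lt.mpr ⟨hDlo, hDhi⟩
  linarith

/-! ## §2 The square-root clause, on the surrogate -/

/-- THEOREM D-sqrt, positive operands, STATED ON THE SURROGATE: under the square-root clause (S),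
if `x` is the half-quantum surrogate of `√a` in `ψ` (`x = n ν` with `(n ν)² = a`, or
`x = (n + ½) ν` with `(n ν)² < a < ((n+1) ν)²`, `ν = quantum ψ / 2`), then
`fl_φ (fl_ψ x) = fl_φ x` (the anatomy of the module docstring, reduced to `sqrt_slip_core`).
[this packet; cite: Figueroa1995; Roux2014, Thm 25] -/
theorem drSqrt_pos {φ ψ : Format} (hE : embedsTest φ ψ = true)
    (hm : 2 * φ.manBits + 3 ≤ ψ.manBits) (hU : 2 * (ψ.qexp + ψ.manBits) ≤ φ.qexp)
    (h1 : 1 ≤ φ.manBits) (hq1 : ψ.qexp + 1 ≤ φ.qexp) {a : MiniFloat φ} (ha : 0 < a.toRat)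
    {x : ℚ} {n : ℕ}
    (hxn : (x = n * (ψ.quantum / 2) ∧ ((n : ℚ) * (ψ.quantum / 2)) ^ 2 = a.toRat) ∨
      (x = ((n : ℚ) + 1 / 2) * (ψ.quantum / 2) ∧ ((n : ℚ) * (ψ.quantum / 2)) ^ 2 < a.toRat ∧
        a.toRat < (((n : ℚ) + 1) * (ψ.quantum / 2)) ^ 2)) :
    (roundNE φ (roundNE ψ x).toRat).toRat = (roundNE φ x).toRat := by
  by_contra h
  have hQφ := φ.quantum_pos; have hQ := ψ.quantum_pos
  set ν : ℚ := ψ.quantum / 2 with hνdef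
  have hν : 0 < ν := by positivity
  have hx : 0 < x := by
    rcases hxn with ⟨hx, hsq⟩ | ⟨hx, -, -⟩
    · rw [hx]
      rcases (show (0:ℚ) ≤ n * ν by positivity).eq_or_lt with h0 | h0
      · rw [← h0] at hsq; simp at hsq; linarith
      · exact h0
    · rw [hx]; positivity
  have hq : ψ.qexp ≤ φ.qexp := by omega
  obtain ⟨zM, hzM⟩ := exists_toRat_eq_maxRat_of_test hE
  have hmax : φ.maxRat ≤ ψ.maxRat := hzM ▸ (le_abs_self _).trans (abs_toRat_le_maxRat zM)
  -- the slip anatomy in `φ`: `fl_ψ x = m = (v+u)/2`, `u = v + G`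
  obtain ⟨v, u, hv0, hvx, hxu, hgap, hmid, hxm⟩ :=
    slip_midpoint_of_pos_of_qexp_lt (by omega) hq1 hmax hx h
  set y := roundNE ψ x with hydef
  obtain ⟨u', hu'⟩ := exists_toRat_eq_add_ulp hv0 (hvx.trans hxu)
  have hule := add_ulp_le_of_lt hv0 (hvx.trans hxu)
  have hGpos : (0:ℚ) < 2 ^ (v.expCode - 1) * φ.quantum := by positivity
  have hueq : u.toRat = v.toRat + 2 ^ (v.expCode - 1) * φ.quantum := by
    rcases hgap u' with h1 | h1 <;> linarith
  have hutop : u.toRat ≤ 2 ^ (φ.manBits + 1 + (v.expCode - 1)) * φ.quantum :=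
    hueq ▸ toRat_add_ulp_le hv0
  have hyu : y.toRat < u.toRat := by rw [hmid]; linarith
  have hy0 : 0 < y.toRat := by rw [hmid]; linarith
  -- quanta: `quantum φ = 2^D quantum ψ`, `quantum ψ = 2 ν`, `2^W ν = 1`
  set D := (φ.qexp - ψ.qexp).toNat with hDdef
  have hDq : φ.quantum = 2 ^ D * ψ.quantum := quantum_eq_two_pow_mul hq
  have hD0 : ((D : ℕ) : ℤ) = φ.qexp - ψ.qexp := Int.toNat_of_nonneg (by omega)
  have hQν : ψ.quantum = 2 * ν := by rw [hνdef]; ring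
  have hqψ1 : ψ.qexp ≤ 1 := by unfold Format.qexp; omega
  set W := (1 - ψ.qexp).toNat with hWdef
  have hW0 : ((W : ℕ) : ℤ) = 1 - ψ.qexp := Int.toNat_of_nonneg (by omega)
  have hWν : (2:ℚ) ^ W * ν = 1 := by
    rw [hνdef]; unfold Format.quantum
    rw [← zpow_natCast, hW0, mul_div_assoc', ← zpow_add₀ two_ne_zero, sub_add_cancel, zpow_one,
      div_self two_ne_zero]
  -- the midpoint in units of `ν`: `m = M ν`, `M = (2V'+1) 2^g`
  have hyQ : y.toRat = (y.scaledMag : ℚ) * ψ.quantum := by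
    rw [toRat_eq_toInt_mul, toInt_eq_scaledMag_of_nonneg hy0.le]; push_cast; rfl
  have hvQ : v.toRat = (v.scaledMag : ℚ) * φ.quantum := by
    rw [toRat_eq_toInt_mul, toInt_eq_scaledMag_of_nonneg hv0]; push_cast; rfl
  obtain ⟨V', hV'⟩ := pow_ulpExp_dvd_scaledMag v
  set g := (v.expCode - 1) + D with hgdef
  set M : ℤ := 2 * (y.scaledMag : ℤ) with hMdef
  have hmν : y.toRat = (M : ℚ) * ν := by rw [hyQ, hMdef, hQν]; push_cast; ring
  have hGν : 2 ^ (v.expCode - 1) * φ.quantum = 2 * (2:ℚ) ^ g * ν := by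
    rw [hDq, hQν, hgdef, pow_add]; ring
  have hMg : M = (2 * (V' : ℤ) + 1) * 2 ^ g := by
    have h1 : (M : ℚ) * ν = ((2 * (V' : ℤ) + 1) * 2 ^ g : ℤ) * ν := by
      rw [← hmν, hmid, hueq, hvQ, hV', hGν, hDq, hQν, hgdef]
      push_cast; ring
    exact_mod_cast mul_right_cancel₀ (ne_of_gt hν) h1
  -- (a) correct rounding in `ψ`: `|x - m| ≤ 2^t ν`
  set t := y.expCode - 1 with htdef
  have hyz : y.toRat < zM.toRat := by
    rw [hzM]; exact hyu.trans_le ((le_abs_self _).trans (abs_toRat_le_maxRat u))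
  have habs : |x - y.toRat| ≤ 2 ^ t * ν := by
    have := abs_sub_roundNE_le_half_ulp_of_pos hy0 hyz
    rw [← hydef, hQν] at this; convert this using 1; rw [htdef]; ring
  -- (b) `M < 2^(P_φ + g + 1)`
  have hMlt : M < (2:ℤ) ^ (φ.manBits + 1 + g + 1) := by
    have h1 : (M : ℚ) * ν < (2:ℚ) ^ (φ.manBits + 1 + g + 1) * ν := by
      rw [← hmν]
      calc y.toRat < u.toRat := hyu
        _ ≤ 2 ^ (φ.manBits + 1 + (v.expCode - 1)) * φ.quantum := hutop
        _ = (2:ℚ) ^ (φ.manBits + 1 + g + 1) * ν := by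
            rw [hDq, hQν, hgdef]; simp only [pow_add, pow_one]; ring
    exact_mod_cast lt_of_mul_lt_mul_right h1 hν.le
  -- (c) the surrogate lies above the least normal number `2^(m_ψ+1) ν` of `ψ` (underflow clause)
  have hUn : 2 * ψ.manBits + 2 ≤ D + 1 + W := by omega
  have haq : φ.quantum ≤ a.toRat := by
    have haS : 1 ≤ a.scaledMag := by
      by_contra h0
      rw [toRat_eq_toInt_mul, toInt_eq_scaledMag_of_nonneg ha.le] at ha
      have : a.scaledMag = 0 := by omega
      rw [this] at ha; simp at ha
    have h1' : (1:ℚ) ≤ a.scaledMag := by exact_mod_cast haS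
    rw [toRat_eq_toInt_mul, toInt_eq_scaledMag_of_nonneg ha.le]; push_cast
    exact le_mul_of_one_le_left hQφ.le h1'
  have hnsq : ((2:ℚ) ^ (ψ.manBits + 1) * ν) ^ 2 ≤ a.toRat := by
    have e1 : ((2:ℚ) ^ (ψ.manBits + 1) * ν) ^ 2 = 2 ^ (2 * ψ.manBits + 2) * ν * ν := by ring
    have e2 : φ.quantum = 2 ^ (D + 1 + W) * ν * ν := by
      rw [hDq, hQν, pow_add, pow_add, pow_one]
      calc (2:ℚ) ^ D * (2 * ν) = 2 ^ D * 2 * ν * (2 ^ W * ν) := by rw [hWν]; ring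
        _ = 2 ^ D * 2 * 2 ^ W * ν * ν := by ring
    have e3 : (2:ℚ) ^ (2 * ψ.manBits + 2) ≤ 2 ^ (D + 1 + W) := pow_le_pow_right₀ (by norm_num) hUn
    rw [e1]; rw [e2] at haq
    exact (mul_le_mul_of_nonneg_right (mul_le_mul_of_nonneg_right e3 hν.le) hν.le).trans haq
  have hnx : (2:ℚ) ^ (ψ.manBits + 1) * ν ≤ x := by
    have hlt : ((2:ℚ) ^ (ψ.manBits + 1) * ν) ^ 2 < (((n : ℚ) + 1) * ν) ^ 2 := by
      rcases hxn with ⟨-, hsq⟩ | ⟨-, -, hhi⟩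
      · have hn0 : (0:ℚ) ≤ n := by positivity
        have : ((n : ℚ) * ν) ^ 2 < (((n : ℚ) + 1) * ν) ^ 2 :=
          pow_lt_pow_left₀ (mul_lt_mul_of_pos_right (by linarith) hν) (by positivity) two_ne_zero
        linarith
      · exact hnsq.trans_lt hhi
    have h2 : (2:ℚ) ^ (ψ.manBits + 1) * ν < ((n : ℚ) + 1) * ν :=
      lt_of_pow_lt_pow_left₀ 2 (by positivity) hlt
    have h3 : ((2 ^ (ψ.manBits + 1) : ℕ) : ℚ) < n + 1 := by
      push_cast; exact lt_of_mul_lt_mul_right h2 hν.le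
    have h4 : 2 ^ (ψ.manBits + 1) ≤ n := by
      have : 2 ^ (ψ.manBits + 1) < n + 1 := by exact_mod_cast h3
      omega
    have h5 : (2:ℚ) ^ (ψ.manBits + 1) ≤ n := by exact_mod_cast h4
    rcases hxn with ⟨hx1, -⟩ | ⟨hx1, -, -⟩ <;> rw [hx1] <;>
      exact mul_le_mul_of_nonneg_right (by linarith) hν.le
  -- (d) hence the midpoint `m = fl_ψ x` is a normal number of `ψ`
  have hE1 : 1 ≤ y.expCode := by
    by_contra hE0
    have hS : y.scaledMag < 2 ^ ψ.manBits := by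
      by_contra hS
      have h0 : y.expCode = 0 := by omega
      have h' := not_lt.mp hS
      have := y.man_lt
      unfold MiniFloat.scaledMag Format.scaled at h'
      rw [if_pos h0] at h'
      omega
    obtain ⟨w, hw⟩ := exists_toRat_eq_add_ulp hy0.le hyz
    have hwe : w.toRat = y.toRat + ψ.quantum := by
      rw [hw, show y.expCode - 1 = 0 by omega, pow_zero, one_mul]
    have hwx : w.toRat ≤ x := by
      have hS' : (y.scaledMag : ℚ) + 1 ≤ 2 ^ ψ.manBits := by exact_mod_cast hS
      calc w.toRat = ((y.scaledMag : ℚ) + 1) * ψ.quantum := by rw [hwe, hyQ]; ring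
        _ ≤ 2 ^ ψ.manBits * ψ.quantum := mul_le_mul_of_nonneg_right hS' hQ.le
        _ = (2:ℚ) ^ (ψ.manBits + 1) * ν := by rw [hQν, pow_succ]; ring
        _ ≤ x := hnx
    have hmono := toRat_roundNE_mono (φ := ψ) hwx
    rw [toRat_roundNE_toRat, ← hydef] at hmono
    linarith
  have hSlo : 2 ^ (ψ.manBits + t) ≤ y.scaledMag := pow_le_scaledMag_of_expCode_pos y hE1
  have hShi : y.scaledMag < 2 ^ (ψ.manBits + 1 + t) := scaledMag_lt_pow_ulpExp y
  obtain ⟨Y', hY'⟩ := pow_ulpExp_dvd_scaledMag y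
  obtain ⟨d, hd⟩ : ∃ d, ψ.manBits = d + 1 := ⟨ψ.manBits - 1, by omega⟩
  have hMlo : (2:ℤ) ^ (d + t + 2) ≤ M := by
    have h1 : ((2 ^ (ψ.manBits + t) : ℕ) : ℤ) ≤ y.scaledMag := by exact_mod_cast hSlo
    push_cast at h1
    rw [hMdef, show d + t + 2 = (ψ.manBits + t) + 1 by omega, pow_succ]; linarith
  have hMhi : M < (2:ℤ) ^ (d + t + 3) := by
    have h1 : (y.scaledMag : ℤ) < ((2 ^ (ψ.manBits + 1 + t) : ℕ) : ℤ) := by exact_mod_cast hShi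
    push_cast at h1
    rw [hMdef, show d + t + 3 = (ψ.manBits + 1 + t) + 1 by omega, pow_succ]; linarith
  have hdvd : (2:ℤ) ^ (t + 1) ∣ M := ⟨Y', by rw [hMdef, hY', htdef, pow_succ]; push_cast; ring⟩
  have hMt : (2:ℤ) ^ t ≤ M := le_trans (pow_le_pow_right₀ (by norm_num) (by omega)) hMlo
  have hM0 : (0:ℤ) ≤ M := le_trans (by positivity) hMt
  -- (e) the operand: `a = Z ν²`, `Z = A₁ 2^κ`, `A₁ < 2^P_φ` odd
  have haS : a.scaledMag ≠ 0 := by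
    intro h0; rw [toRat_eq_toInt_mul, toInt_eq_scaledMag_of_nonneg ha.le, h0] at ha; simp at ha
  obtain ⟨α, A₁, hA₁, hAα, hA₁lt⟩ := exists_odd_part a haS
  set κ := α + D + 1 + W with hκdef
  set Z : ℤ := (A₁ : ℤ) * 2 ^ κ with hZdef
  have hZq : a.toRat = (Z : ℚ) * ν ^ 2 := by
    rw [toRat_eq_toInt_mul, toInt_eq_scaledMag_of_nonneg ha.le, hAα, hZdef, hκdef, hDq, hQν]
    push_cast
    calc ((2:ℚ) ^ α * A₁) * (2 ^ D * (2 * ν)) = 2 ^ α * A₁ * 2 ^ D * 2 * ν * (2 ^ W * ν) := by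
          rw [hWν, mul_one]; ring
      _ = A₁ * 2 ^ (α + D + 1 + W) * ν ^ 2 := by simp only [pow_add, pow_one]; ring
  have hA' : (A₁ : ℤ) < 2 ^ (φ.manBits + 1) := by exact_mod_cast hA₁lt
  -- (f) the surrogate pins `Z` against `M`
  have hlo : ((M : ℚ) - 2 ^ t) * ν ≤ x := by have := (abs_le.mp habs).1; rw [hmν] at this; linarith
  have hhi : x ≤ ((M : ℚ) + 2 ^ t) * ν := by have := (abs_le.mp habs).2; rw [hmν] at this; linarith
  have hMt' : (0:ℤ) ≤ M - 2 ^ t := by linarith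
  have key : (M - 2 ^ t) ^ 2 ≤ Z ∧ Z ≤ (M + 2 ^ t) ^ 2 ∧ Z ≠ M ^ 2 := by
    rcases hxn with ⟨hx1, hsq⟩ | ⟨hx1, hsqlo, hsqhi⟩
    · -- exact root `x = n ν`, `Z = n²`
      have hZn : Z = (n : ℤ) ^ 2 := by
        have e : ((n : ℚ) * ν) ^ 2 = ((n : ℤ) ^ 2 : ℤ) * ν ^ 2 := by push_cast; ring
        rw [hZq, e] at hsq
        exact_mod_cast (mul_right_cancel₀ (by positivity) hsq).symm
      have h1 : M - 2 ^ t ≤ (n : ℤ) := by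
        have : ((M - 2 ^ t : ℤ) : ℚ) * ν ≤ (n : ℚ) * ν := by push_cast; rw [← hx1]; exact hlo
        exact_mod_cast le_of_mul_le_mul_right this hν
      have h2 : (n : ℤ) ≤ M + 2 ^ t := by
        have : (n : ℚ) * ν ≤ ((M + 2 ^ t : ℤ) : ℚ) * ν := by push_cast; rw [← hx1]; exact hhi
        exact_mod_cast le_of_mul_le_mul_right this hν
      refine ⟨by rw [hZn]; exact pow_le_pow_left₀ hMt' h1 2,
        by rw [hZn]; exact pow_le_pow_left₀ (by positivity) h2 2, fun hZM => hxm ?_⟩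
      have hnM : (n : ℤ) = M := by
        have := hZn.symm.trans hZM
        exact (pow_left_inj₀ (by positivity) hM0 two_ne_zero).mp this
      rw [hx1, hmν, ← hnM]; norm_cast
    · -- midpoint `x = (n + ½) ν`, `n² < Z < (n+1)²`
      have hZlo' : (n : ℤ) ^ 2 < Z := by
        have : (((n : ℤ) ^ 2 : ℤ) : ℚ) * ν ^ 2 < (Z : ℚ) * ν ^ 2 := by
          rw [← hZq]; push_cast; rw [← mul_pow]; exact hsqlo
        exact_mod_cast lt_of_mul_lt_mul_right this (by positivity)
      have hZhi' : Z < ((n : ℤ) + 1) ^ 2 := by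
        have : (Z : ℚ) * ν ^ 2 < ((((n : ℤ) + 1) ^ 2 : ℤ) : ℚ) * ν ^ 2 := by
          rw [← hZq]; push_cast; rw [← mul_pow]; exact hsqhi
        exact_mod_cast lt_of_mul_lt_mul_right this (by positivity)
      have h1 : M - 2 ^ t ≤ (n : ℤ) := by
        by_contra hc
        have hc' : ((n : ℤ) : ℚ) + 1 ≤ ((M - 2 ^ t : ℤ) : ℚ) := by
          exact_mod_cast (show (n:ℤ) + 1 ≤ M - 2 ^ t by omega)
        push_cast at hc'
        rw [hx1] at hlo; have := mul_le_mul_of_nonneg_right hc' hν.le; linarith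
      have h2 : (n : ℤ) + 1 ≤ M + 2 ^ t := by
        by_contra hc
        have hc' : ((M + 2 ^ t : ℤ) : ℚ) ≤ (n : ℚ) := by
          exact_mod_cast (show M + 2 ^ t ≤ (n:ℤ) by omega)
        push_cast at hc'
        rw [hx1] at hhi; have := mul_le_mul_of_nonneg_right hc' hν.le; linarith
      refine ⟨(pow_le_pow_left₀ hMt' h1 2).trans hZlo'.le,
        hZhi'.le.trans (pow_le_pow_left₀ (by positivity) h2 2), fun hZM => ?_⟩
      rw [hZM] at hZlo' hZhi'
      have h3 : (n : ℤ) < M := lt_of_pow_lt_pow_left₀ 2 hM0 hZlo'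
      have h4 : M < (n : ℤ) + 1 := lt_of_pow_lt_pow_left₀ 2 (by positivity) hZhi'
      omega
  obtain ⟨hZlo, hZhi, hne⟩ := key
  exact sqrt_slip_core (P := φ.manBits + 1) (d := d) hA' (by omega) hMg hMlo hMhi hMlt hdvd
    hZlo hZhi hne

end Summit.Ventures.CertifiedArithmetic
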